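import Summits.BirchSwinnertonDyer.Rank1Residual.X11b.KolyvaginFrobeniusEigenparts
import HarnessLib

/-!
# T1 JET (cell `bsd-jet`), road K, input (L1) — brick A (pure algebra): a BALANCED involution on a
# finite abelian group of order `p^{2k}` and exponent `p^k`

HONEST FRAMING (programme file `BSD-LIT2PART-PROGRAMME-v1.md` §HONESTY, verbatim): «no tranche here
proves BSD; ARM L moves the LITERAL column of an r ≤ 1 census into the kernel-proved-modulo-named-print
column; ARM P changes what «named print» is worth.» THEOREMS ONLY (seat `bsd-jet-pv-1`, session g6;
`--supports stmt-BirchSwinnertonDyer-14418`, helper): no definition, no named fact, no `sorry`.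
Nothing is booked; 0 classes move.

## What

The Kolyvagin-prime local term `hloc` of the H63 line (`JET.tamagawaExponent_le_mInfty_of_localInputs`,
binder `hloc`; reduced by session g5 to `#(Kum_λ ∩ ker(σ_{*,λ} − s)) = p^k`) is, at bottom, the
statement that complex conjugation acts on `E[p^k] ≅ H¹_ur(K_λ, E[p^k])` as an involution whose two
eigenspaces have `p^k` elements each (Jetchev 2008 §3.2 (2): `H¹_f(K_λ, E[p^k])^±` free of rank one
over `ℤ/p^k`). This file isolates the group theory:

* `natCard_ker_sub_id_mul_natCard_ker_add_id` — for an involution `T` of a finite abelian group `M`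
  killed by an ODD `N`: `#ker(T − 1) · #ker(T + 1) = #M` (`x = m(x + Tx) + m(x − Tx)`, `2m = N + 1`);
* `natCard_le_pow_of_natCard_inf_torsionBy_le` — a subgroup `H ≤ M` killed by `p^k` whose `p`-torsion
  has at most `p` elements has at most `p^k` elements (x11b3's `natCard_torsionBy_pow_le`:
  `#H[p^j] ≤ #H[p]^j`);
* **`natCard_ker_sub_smul_id_eq_pow`** — if `#M = p^{2k}`, `p^k M = 0`, `p` odd, `T² = 1` and BOTH
  `ker(T ∓ 1) ∩ M[p]` have at most `p` elements, then `#ker(T − s) = p^k` for `s = ±1`.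

Consumers: the `ℚ`-Frobenius at a Kolyvagin prime on `E[p^k]` (trace `a_ℓ ≡ 0`, so `Frob ≠ ±1` on
`E[p]`) and the adapted lift of complex conjugation on `H¹_ur(K_λ, E[p^k])`.

References (locators only; no cited FACT is declared): [cite: Jetchev2008, §3.2 (2)–(3) (p. 815)]
[cite: GrossLMS1991, §3 (3.2)–(3.4)]. Design: `Type*`-polymorphic; kernels as `AddSubgroup`s of
`T - s • AddMonoidHom.id M` to match `conjActPlace … - s • AddMonoidHom.id _` downstream. Axioms:
`propext`, `Classical.choice`, `Quot.sound`.
-/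

set_option autoImplicit false

noncomputable section

open scoped Classical
open Function

namespace Summit.BirchSwinnertonDyer.Rank1Residual.JET.GlobalDuality

section Balanced

variable {M : Type*} [AddCommGroup M]

/-- Membership in `AddSubgroup.torsionBy`: `x ∈ G[n] ↔ n • x = 0`. [folklore] -/
theorem mem_torsionBy_iff_zsmul_eq_zero {n : ℤ} {x : M} :
    x ∈ AddSubgroup.torsionBy M n ↔ n • x = 0 := by
  rw [AddSubgroup.torsionBy, Submodule.mem_toAddSubgroup, Submodule.mem_torsionBy_iff]

/-- **`#ker(T − 1) · #ker(T + 1) = #M`** for an involution `T` of a finite abelian group `M` killed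
by an odd `N`: `(a, b) ↦ a + b` is a bijection `ker(T − 1) × ker(T + 1) → M` (inverse
`x ↦ (m(x + Tx), m(x − Tx))`, `2m = N + 1`; the intersection is killed by `2` and by `N`).
[cite: Jetchev2008, §3.2 (p. 815), decomposition into `±`-eigenspaces for odd `p`] -/
theorem natCard_ker_sub_id_mul_natCard_ker_add_id [Finite M] {N : ℕ} (hN : Odd N)
    (hM : ∀ x : M, N • x = 0) (T : M →+ M) (hT : ∀ x, T (T x) = x) :
    Nat.card (T - AddMonoidHom.id M).ker * Nat.card (T + AddMonoidHom.id M).ker = Nat.card M := by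
  obtain ⟨m, hm⟩ := hN
  -- `(m + 1) · 2 = N + 1` acts as the identity
  have h2 : ∀ x : M, (m + 1) • (2 • x) = x := fun x => by
    rw [← mul_nsmul', show (m + 1) * 2 = N + 1 by omega, add_nsmul, hM, one_nsmul, zero_add]
  have hmemA : ∀ {a : M}, a ∈ (T - AddMonoidHom.id M).ker ↔ T a = a := fun {a} => by
    rw [AddMonoidHom.mem_ker, AddMonoidHom.sub_apply, AddMonoidHom.id_apply, sub_eq_zero]
  have hmemB : ∀ {b : M}, b ∈ (T + AddMonoidHom.id M).ker ↔ T b = -b := fun {b} => by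
    rw [AddMonoidHom.mem_ker, AddMonoidHom.add_apply, AddMonoidHom.id_apply, add_eq_zero_iff_eq_neg]
  let f : (T - AddMonoidHom.id M).ker × (T + AddMonoidHom.id M).ker → M := fun ab => ab.1.1 + ab.2.1
  have hf : Bijective f := by
    constructor
    · rintro ⟨⟨a, ha⟩, ⟨b, hb⟩⟩ ⟨⟨a', ha'⟩, ⟨b', hb'⟩⟩ h
      change a + b = a' + b' at h
      rw [hmemA] at ha ha'
      rw [hmemB] at hb hb'
      have hd : a - a' = b' - b := by
        rw [sub_eq_iff_eq_add, sub_add_eq_add_sub, eq_sub_iff_add_eq, h, add_comm]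
      -- `d = a - a' = b' - b` is fixed and negated by `T`, so `2d = 0`, so `d = 0`
      have e1 : T (a - a') = a - a' := by rw [map_sub, ha, ha']
      have e2 : T (b' - b) = -(b' - b) := by rw [map_sub, hb, hb', neg_sub_neg, neg_sub]
      rw [hd] at e1
      rw [e1] at e2
      have h0 : 2 • (b' - b) = 0 := by
        rw [two_nsmul]
        exact add_eq_zero_iff_eq_neg.mpr e2
      have hz : b' - b = 0 := by rw [← h2 (b' - b), h0, nsmul_zero]
      have ha0 : a = a' := sub_eq_zero.mp (hd.trans hz)
      have hb0 : b = b' := (sub_eq_zero.mp hz).symm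
      subst ha0 hb0
      rfl
    · intro x
      refine ⟨(⟨(m + 1) • (x + T x), ?_⟩, ⟨(m + 1) • (x - T x), ?_⟩), ?_⟩
      · rw [hmemA, map_nsmul, map_add, hT, add_comm (T x) x]
      · rw [hmemB, map_nsmul, map_sub, hT, ← neg_nsmul, neg_sub]
      · change (m + 1) • (x + T x) + (m + 1) • (x - T x) = x
        rw [← nsmul_add, add_add_sub_cancel, ← two_nsmul, h2]
  rw [← Nat.card_prod, Nat.card_congr (Equiv.ofBijective f hf)]

/-- **A subgroup killed by `p^k` whose `p`-torsion has at most `p` elements has at most `p^k`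
elements**: `#H = #H[p^k] ≤ #H[p]^k ≤ p^k` (x11b3 `natCard_torsionBy_pow_le`). [folklore] -/
theorem natCard_le_pow_of_natCard_inf_torsionBy_le [Finite M] {p : ℕ} (k : ℕ) (H : AddSubgroup M)
    (hH : ∀ x ∈ H, p ^ k • x = 0)
    (h1 : Nat.card ↥(H ⊓ AddSubgroup.torsionBy M (p : ℤ)) ≤ p) : Nat.card H ≤ p ^ k := by
  -- `#H[p] ≤ p`: `H[p]` injects into `H ∩ M[p]`
  have hval : ∀ x : AddSubgroup.torsionBy H (p : ℤ), (p : ℤ) • ((x : H) : M) = 0 := fun x => by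
    have hx : (p : ℤ) • (x : H) = 0 := mem_torsionBy_iff_zsmul_eq_zero.mp x.2
    rw [← AddSubgroup.coe_zsmul, hx, AddSubgroup.coe_zero]
  have h1' : Nat.card (AddSubgroup.torsionBy H (p : ℤ)) ≤ p := by
    refine le_trans (Nat.card_le_card_of_injective
      (fun x : AddSubgroup.torsionBy H (p : ℤ) =>
        (⟨((x : H) : M), ⟨(x : H).2, mem_torsionBy_iff_zsmul_eq_zero.mpr (hval x)⟩⟩ :
          ↥(H ⊓ AddSubgroup.torsionBy M (p : ℤ))))
      fun x y hxy => ?_) h1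
    apply Subtype.ext; apply Subtype.ext
    exact congrArg (fun z : ↥(H ⊓ AddSubgroup.torsionBy M (p : ℤ)) => (z : M)) hxy
  -- `H = H[p^k]`
  have htop : AddSubgroup.torsionBy H ((p : ℤ) ^ k) = ⊤ := by
    ext x
    rw [mem_torsionBy_iff_zsmul_eq_zero]
    refine ⟨fun _ => AddSubgroup.mem_top x, fun _ => Subtype.ext ?_⟩
    rw [← Nat.cast_pow, natCast_zsmul, AddSubgroup.coe_nsmul, AddSubgroup.coe_zero]
    exact hH x.1 x.2
  have h := X11b.KolyvaginH44.natCard_torsionBy_pow_le h1' k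
  rwa [htop, AddSubgroup.card_top] at h

/-- **A balanced involution.** Let `M` be a finite abelian group of order `p^{2k}` killed by `p^k`
(`p` an odd prime), `T` an involution of `M` such that BOTH `ker(T − 1) ∩ M[p]` and
`ker(T + 1) ∩ M[p]` have at most `p` elements (i.e. `T ≢ ±1` on each line of `M[p]`-eigenvectors —
for `E[p^k]` at a Kolyvagin prime: `tr(Frob_ℓ | E[p]) = a_ℓ ≡ 0 ≠ ±2`). Then `#ker(T − s) = p^k` for
`s = ±1`: each eigenspace has at most `p^k` elements (`natCard_le_pow_of_natCard_inf_torsionBy_le`)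
and their product is `p^{2k}` (`natCard_ker_sub_id_mul_natCard_ker_add_id`). This is the group
theory behind Jetchev 2008 §3.2 (2) «`H¹_f(K_λ, E[p^k])^±` free of rank one over `ℤ/p^k`» and Gross
1991 (3.4). [cite: Jetchev2008, §3.2 (2) (p. 815)] [cite: GrossLMS1991, §3 (3.3)–(3.4)] -/
theorem natCard_ker_sub_smul_id_eq_pow [Finite M] {p k : ℕ} (hp : p.Prime) (hp2 : p ≠ 2)
    (hcard : Nat.card M = p ^ (2 * k)) (hM : ∀ x : M, p ^ k • x = 0)
    (T : M →+ M) (hT : ∀ x, T (T x) = x)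
    (hle : ∀ s : ℤ, s = 1 ∨ s = -1 →
      Nat.card ↥((T - s • AddMonoidHom.id M).ker ⊓ AddSubgroup.torsionBy M (p : ℤ)) ≤ p)
    {s : ℤ} (hs : s = 1 ∨ s = -1) :
    Nat.card (T - s • AddMonoidHom.id M).ker = p ^ k := by
  have hA1 : (T - (1 : ℤ) • AddMonoidHom.id M).ker = (T - AddMonoidHom.id M).ker := by
    rw [one_smul]
  have hB1 : (T - (-1 : ℤ) • AddMonoidHom.id M).ker = (T + AddMonoidHom.id M).ker := by
    rw [neg_smul, one_smul, sub_neg_eq_add]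
  -- both eigenspaces have at most `p^k` elements
  have hA : Nat.card (T - AddMonoidHom.id M).ker ≤ p ^ k := by
    refine natCard_le_pow_of_natCard_inf_torsionBy_le k _ (fun x _ => hM x) ?_
    have h := hle 1 (Or.inl rfl)
    rwa [hA1] at h
  have hB : Nat.card (T + AddMonoidHom.id M).ker ≤ p ^ k := by
    refine natCard_le_pow_of_natCard_inf_torsionBy_le k _ (fun x _ => hM x) ?_
    have h := hle (-1) (Or.inr rfl)
    rwa [hB1] at h
  -- and their product is `p^{2k}`
  have hodd : Odd (p ^ k) := (hp.odd_of_ne_two hp2).pow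
  have hprod := natCard_ker_sub_id_mul_natCard_ker_add_id hodd hM T hT
  rw [hcard, two_mul, pow_add] at hprod
  have hpk : 0 < p ^ k := pow_pos hp.pos k
  have hAeq : Nat.card (T - AddMonoidHom.id M).ker = p ^ k := by
    refine le_antisymm hA (Nat.le_of_mul_le_mul_right ?_ hpk)
    calc p ^ k * p ^ k = Nat.card (T - AddMonoidHom.id M).ker * Nat.card (T + AddMonoidHom.id M).ker :=
          hprod.symm
      _ ≤ Nat.card (T - AddMonoidHom.id M).ker * p ^ k := Nat.mul_le_mul_left _ hB
  have hBeq : Nat.card (T + AddMonoidHom.id M).ker = p ^ k := by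
    refine le_antisymm hB (Nat.le_of_mul_le_mul_left ?_ hpk)
    calc p ^ k * p ^ k = Nat.card (T - AddMonoidHom.id M).ker * Nat.card (T + AddMonoidHom.id M).ker :=
          hprod.symm
      _ ≤ p ^ k * Nat.card (T + AddMonoidHom.id M).ker := Nat.mul_le_mul_right _ hA
  rcases hs with rfl | rfl
  · rw [hA1, hAeq]
  · rw [hB1, hBeq]

end Balanced

end Summit.BirchSwinnertonDyer.Rank1Residual.JET.GlobalDuality

end
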